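import Literature.AnabelianGeometry.EtaleTheta.Discharge.Sec3RigidOverBaseRefutedAtThetaTwistTowerOfSlim
import Literature.AnabelianGeometry.SemiGraphs.CosetCategoriesSlimTempered
import Mathlib.Data.Nat.Factorization.Basic
import HarnessLib

/-!
# «GRP₃′ SLIM»: the compatible shear-semidirect ζ-twisted Kummer–Tate group `Ẑ(1)^r ⋊ (Ẑˣ × ℤ_γ)` is temp-slim ([FrdI] §0), its
# connected temperoid `B^temp(Compat₃′)⁰` is a SLIM category ([SemiAnbd] Rmk. 3.4.1), and at the [EtTh] Def. 3.6 design carrier of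
# record `temperedFrobenioidSmall` the (iv) injectivity conclusion `RigidOverBase` FAILS OUTRIGHT (★ p544475 made unconditional)

S. Mochizuki, *The geometry of Frobenioids I* [MochizukiFrdI2008], §0 p.13 («slim»: every open subgroup has trivial centraliser)
[cite: MochizukiFrdI2008, §0 p.13]; *Semi-graphs of anabelioids* [MochizukiSemiAnbd2006], Rmk. 3.4.1 p.36; *The étale theta function …*
[MochizukiEtTh2009], Def. 3.3 (ii) p.73, Def. 3.6 p.77.  Consumer locus [IUTchI] Cor. 5.3 (iv) p.144 [claim: Mochizuki2012, status: disputed].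
PROOF-ONLY, 0 def (abc-iut cell; seat abc-iut-L5-t11 gen 21, offer «GRP3′-SLIM», abc-iut-L5-lead RULINGS #221; the question «IsTempered +
IsSlimGroup of GRP₃′» isolated by RULINGS #189 (3) under ★ `not_rigidOverBase_temperedFrobenioidSmall_of_isSlim` (p544475, abc-iut-L5-t1),
`IsTempered Compat₃'` being abc-iut-L1-t6's ★ `isTempered_compat₃'`).  Nothing landed is edited; BY NAME: `Compat r σ`, `vSub`, `exists_vSub_subset_of_isOpen`,
`res_coord_eq`, `resC_right_eq`, `thetaShear`, `isSlim_connectedPart_bTemp`, ★ p544475.  ROUTE: every open subgroup contains some `vSub n`; a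
centraliser element of `vSub n` commutes with the KUMMER PROBES `((M n · e_j)_i, 1)` — forcing character `1` (diagonal entries of `χ·σ̄_a`,
`σ a j j = 1`) and `σ a = 1` (off-diagonal entries) by the factorial cofinality `M m · N ∣ M (m + N)` of `M i = (i+2)!` — and with the UNIT
PROBES `(1, (u, 1))` (for each prime `p` a compatible unit family `u_i ≡ 1 + t·M n (mod ordProj[p] (M i))`, `≡ 1 (mod ordCompl[p] (M i))`,
`p ∤ 1 + t·M n`, glued by the Chinese remainder theorem) — forcing every Kummer class of index `m` to be divisible by every prime power of
`M m`, i.e. to vanish.  Main decls: **`isSlimGroup_compat`**, **`isSlimGroup_compat₃'`**, **`isSlim_connectedPart_bTemp_compat₃'`**,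
**`not_rigidOverBase_temperedFrobenioidSmall (R S)`** (one call of ★ p544475).
HONEST LABEL: `Compat 3 thetaShear` / `temperedFrobenioidSmall` are the cell's class-(b) DESIGN models (two unlabelled cusps per component),
NOT the tempered fundamental group / tempered Frobenioid of a Tate curve in print (labelled cusps, [EtTh] Prop. 1.3); refutable-as-typed at a
design carrier ≠ refuted in print; OUR theorems about OUR model; no token moved; no side taken on [IUTchIII] Cor. 3.12; no abc claim.
-/

noncomputable section

namespace Literature.AnabelianGeometry.EtaleTheta

open CategoryTheory Function Literature.AlgebraicGeometry.Frobenioids Literature.AlgebraicGeometry.Frobenioids.QuasiTemperoid Literature.AnabelianGeometry.SemiGraphs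

namespace TateTowerKummerTwistRShear

open TateTowerKummerTwist (M Cst M_dvd res resC)
open TateTowerKummerTwistR (Kum resK resK_apply)

variable (r : ℕ) (σ : Multiplicative ℤ →* Matrix (Fin r) (Fin r) ℤ)


/-- **Factorial cofinality**: `M m · N ∣ M (m + N)` for `0 < N` (`(m+2)! · N! ∣ (m+2+N)!`). [cite: MochizukiEtTh2009, Def 3.3 (ii) p.73] -/
theorem M_mul_dvd_M_add (m : ℕ) {N : ℕ} (hN : 0 < N) : M m * N ∣ M (m + N) := by
  refine (Nat.mul_dvd_mul_left _ (Nat.dvd_factorial hN le_rfl)).trans ?_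
  have h2 := Nat.factorial_mul_factorial_dvd_factorial_add (m + 2) N
  rwa [show m + 2 + N = m + N + 2 by omega] at h2

/-- A compatible family of units with `u_i · N = N` for every `i` is trivial (`0 < N`; index `m` read at `m + N`). [cite: MochizukiEtTh2009, §1 p.13] -/
theorem eq_one_of_mul_natCast {N : ℕ} (hN : 0 < N) (u : Cst) (hu : ∀ i j (h : i ≤ j), resC h (u j) = u i)
    (h0 : ∀ i, (u i : ZMod (M i)) * N = N) (m : ℕ) : u m = 1 := by
  haveI : NeZero (M (m + N)) := ⟨(Nat.factorial_pos _).ne'⟩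
  have h1 : ((((u (m + N) : ZMod (M (m + N)))).val * N : ℕ) : ZMod (M (m + N))) = ((1 * N : ℕ) : ZMod (M (m + N))) := by
    rw [Nat.cast_mul, ZMod.natCast_zmod_val, h0, one_mul]
  have h3 : ((u (m + N) : ZMod (M (m + N)))).val ≡ 1 [MOD M m] := Nat.ModEq.mul_right_cancel' hN.ne'
    (Nat.ModEq.of_dvd (M_mul_dvd_M_add m hN) ((ZMod.natCast_eq_natCast_iff _ _ _).1 h1))
  refine Units.ext ?_
  rw [← hu m (m + N) (Nat.le_add_right m N), Units.coe_map, RingHom.toMonoidHom_eq_coe, MonoidHom.coe_coe, ZMod.castHom_apply,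
    ZMod.cast_eq_val, Units.val_one, ← Nat.cast_one]
  exact (ZMod.natCast_eq_natCast_iff _ _ _).2 h3

/-- An integer `z` with `z · N ≡ 0 (mod M i)` for every `i` vanishes (`0 < N`; read at `|z| + N`: `(|z|+2)! > |z|`). [cite: MochizukiEtTh2009, Def 3.3 (ii) p.73] -/
theorem int_eq_zero_of_mul_natCast {N : ℕ} (hN : 0 < N) (z : ℤ) (h0 : ∀ i, ((z * N : ℤ) : ZMod (M i)) = 0) : z = 0 := by
  have h2 : ((M z.natAbs * N : ℕ) : ℤ) ∣ z * N :=
    (Int.natCast_dvd_natCast.2 (M_mul_dvd_M_add z.natAbs hN)).trans ((ZMod.intCast_zmod_eq_zero_iff_dvd _ _).1 (h0 _))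
  rw [Nat.cast_mul] at h2
  have h4 : M z.natAbs ∣ z.natAbs := by
    simpa only [Int.natAbs_natCast] using Int.natAbs_dvd_natAbs.2 (Int.dvd_of_mul_dvd_mul_right (by exact_mod_cast hN.ne') h2)
  exact Int.natAbs_eq_zero.1 (Nat.eq_zero_of_dvd_of_lt h4 (lt_of_lt_of_le (by omega) (Nat.self_le_factorial (z.natAbs + 2))))


/-- **Kummer probe** `((M n · e_j)_i, 1) ∈ vSub n` (restriction fixes integers; `M i ∣ M n` for `i < n`). [cite: MochizukiSemiAnbd2006, Def 3.1 (i) p.33] -/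
theorem exists_kummerProbe (n : ℕ) (j : Fin r) : ∃ x ∈ vSub r σ n, (x : Grp r σ) =
      ofKum r σ (Multiplicative.ofAdd fun i => (Pi.single j ((M n : ℕ) : ZMod (M i)) : Fin r → ZMod (M i))) := by
  refine ⟨⟨ofKum r σ (Multiplicative.ofAdd fun i => (Pi.single j ((M n : ℕ) : ZMod (M i)) : Fin r → ZMod (M i))),
    ⟨fun i i' h => ?_, fun i i' h => map_one _⟩⟩, ⟨rfl, fun i hi => ⟨?_, rfl⟩⟩, rfl⟩
  · change resK r h (Pi.single j ((M n : ℕ) : ZMod (M i')) : Fin r → ZMod (M i')) = (Pi.single j ((M n : ℕ) : ZMod (M i)) : Fin r → ZMod (M i))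
    funext a
    rw [resK_apply, Pi.single_apply, Pi.single_apply, apply_ite (res h), map_natCast, map_zero]
  · change (Pi.single j ((M n : ℕ) : ZMod (M i)) : Fin r → ZMod (M i)) = 0
    rw [(ZMod.natCast_eq_zero_iff _ _).2 (M_dvd hi.le), Pi.single_zero]

/-- **The unit probe at a prime `p`**: a compatible family of units `u_i ≡ 1 + t·M n (mod ordProj[p] (M i))`, `u_i ≡ 1 (mod ordCompl[p] (M i))`
(`0 < t`, `p ∤ 1 + t·M n`; glued by the Chinese remainder theorem) with `(1, (u, 1)) ∈ vSub n`. [cite: MochizukiSemiAnbd2006, Def 3.1 (i) p.33] -/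
theorem exists_unitProbe (p n : ℕ) (hp : p.Prime) : ∃ (t : ℕ) (u : Cst) (x : Compat r σ), 0 < t ∧ x ∈ vSub r σ n ∧
    (x : Grp r σ) = SemidirectProduct.inr (u, 1) ∧ ∀ i, ZMod.castHom (Nat.ordProj_dvd (M i) p) (ZMod (ordProj[p] (M i))) (u i : ZMod (M i)) =
      ((1 + t * M n : ℕ) : ZMod (ordProj[p] (M i))) := by
  obtain ⟨t, ht0, ht⟩ : ∃ t, 0 < t ∧ ¬ p ∣ 1 + t * M n := by
    by_cases h1 : p ∣ 1 + 1 * M n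
    · refine ⟨2, two_pos, fun h2 => hp.one_lt.ne' (Nat.dvd_one.1 ?_)⟩
      have h5 : p ∣ (1 + 1 * M n) - ((1 + 2 * M n) - (1 + 1 * M n)) := Nat.dvd_sub h1 (Nat.dvd_sub h2 h1)
      rwa [show (1 + 1 * M n) - ((1 + 2 * M n) - (1 + 1 * M n)) = 1 by omega] at h5
    · exact ⟨1, one_pos, h1⟩
  have hco : ∀ i, Nat.Coprime (ordProj[p] (M i)) (ordCompl[p] (M i)) := fun i => (Nat.coprime_ordCompl hp (Nat.factorial_pos (i + 2)).ne').pow_left _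
  let z : ℕ → ℕ := fun i => (Nat.chineseRemainder (hco i) (1 + t * M n) 1 : ℕ)
  have hz : ∀ i, z i ≡ 1 + t * M n [MOD ordProj[p] (M i)] ∧ z i ≡ 1 [MOD ordCompl[p] (M i)] := fun i =>
    (Nat.chineseRemainder (hco i) (1 + t * M n) 1).2
  have hzco : ∀ i, Nat.Coprime (z i) (M i) := fun i => by
    simpa only [Nat.ordProj_mul_ordCompl_eq_self] using Nat.Coprime.mul_right
      (((hz i).1.gcd_eq.trans (Nat.Coprime.pow_right _ (Nat.coprime_comm.1 ((Nat.Prime.coprime_iff_not_dvd hp).2 ht)))) : Nat.Coprime _ _)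
      (((hz i).2.gcd_eq.trans (Nat.gcd_one_left _)) : Nat.Coprime (z i) (ordCompl[p] (M i)))
  have hzres : ∀ {i j : ℕ}, i ≤ j → z j ≡ z i [MOD M i] := fun {i j} h => by
    simpa only [Nat.ordProj_mul_ordCompl_eq_self] using (Nat.modEq_and_modEq_iff_modEq_mul (hco i)).1
      ⟨((hz j).1.of_dvd (Nat.ordProj_dvd_ordProj_of_dvd (Nat.factorial_pos (j + 2)).ne' (M_dvd h) p)).trans (hz i).1.symm,
        ((hz j).2.of_dvd (Nat.ordCompl_dvd_ordCompl_of_dvd (M_dvd h) p)).trans (hz i).2.symm⟩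
  have hzone : ∀ {i : ℕ}, i ≤ n → z i ≡ 1 [MOD M i] := fun {i} hi => by
    have hP : ordProj[p] (M i) ∣ t * M n := (Nat.ordProj_dvd (M i) p).trans ((M_dvd hi).trans (Nat.dvd_mul_left _ _))
    have h3 : 1 + t * M n ≡ 1 + 0 [MOD ordProj[p] (M i)] := Nat.ModEq.add_left 1 ((Nat.modEq_zero_iff_dvd).2 hP)
    rw [add_zero] at h3
    simpa only [Nat.ordProj_mul_ordCompl_eq_self] using (Nat.modEq_and_modEq_iff_modEq_mul (hco i)).1 ⟨(hz i).1.trans h3, (hz i).2⟩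
  let u : Cst := fun i => ZMod.unitOfCoprime (z i) (hzco i)
  have hu : ∀ i, (u i : ZMod (M i)) = (z i : ℕ) := fun i => ZMod.coe_unitOfCoprime _ _
  refine ⟨t, u, ⟨SemidirectProduct.inr (u, 1), ⟨fun i j h => ?_, fun i j h => Units.ext ?_⟩⟩, ht0, ⟨rfl, fun i hi => ⟨?_, Units.ext ?_⟩⟩, rfl,
    fun i => ?_⟩
  · rw [SemidirectProduct.left_inr, toAdd_one, Pi.zero_apply, Pi.zero_apply, map_zero]
  · rw [SemidirectProduct.right_inr, Units.coe_map, RingHom.toMonoidHom_eq_coe, MonoidHom.coe_coe, hu, hu, map_natCast]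
    exact (ZMod.natCast_eq_natCast_iff _ _ _).2 (hzres h)
  · exact congrFun toAdd_one i
  · change (u i : ZMod (M i)) = ((1 : (ZMod (M i))ˣ) : ZMod (M i))
    rw [hu, Units.val_one, ← Nat.cast_one]
    exact (ZMod.natCast_eq_natCast_iff _ _ _).2 (hzone hi.le)
  · rw [hu, map_natCast]
    exact (ZMod.natCast_eq_natCast_iff _ _ _).2 (hz i).1


variable {r σ}

/-- Commuting with a Kummer element `(x, 1)` means `x` is fixed by the `(χ, σ)`-action of the right component. [cite: MochizukiEtTh2009, §1 p.13] -/
theorem act_eq_of_commute_ofKum (g : Grp r σ) (x : Kum r) (h : ofKum r σ x * g = g * ofKum r σ x) : act r σ g.right x = x := by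
  have h1 : (ofKum r σ x * g).left = (g * ofKum r σ x).left := congrArg _ h
  rw [SemidirectProduct.mul_left, SemidirectProduct.mul_left] at h1
  change x * act r σ 1 g.left = g.left * act r σ g.right x at h1
  rw [map_one, MulAut.one_apply, mul_comm x] at h1
  exact (mul_left_cancel h1).symm

/-- Against the Kummer probe `M n · e_j`, a centraliser element `(k,(c,a))` has `(M n · e_j)_l = χ_i(c) · (σ̄_a)_{l j} · M n`. [cite: MochizukiFrdI2008, §0 p.13] -/
theorem kummerProbe_entry {n : ℕ} {g : Compat r σ} (hg : g ∈ Subgroup.centralizer (vSub r σ n : Set (Compat r σ))) (j l : Fin r) (i : ℕ) :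
    (Pi.single j ((M n : ℕ) : ZMod (M i)) : Fin r → ZMod (M i)) l =
      ((g : Grp r σ).right.1 i : ZMod (M i)) * ((red r i (σ (g : Grp r σ).right.2)) l j * ((M n : ℕ) : ZMod (M i))) := by
  obtain ⟨x, hx, hxe⟩ := exists_kummerProbe r σ n j
  have hc : (x : Grp r σ) * (g : Grp r σ) = (g : Grp r σ) * (x : Grp r σ) := congrArg Subtype.val (Subgroup.mem_centralizer_iff.1 hg x hx)
  rw [hxe] at hc
  have h2 := congrArg (fun k : Kum r => k.toAdd i l) (act_eq_of_commute_ofKum (g : Grp r σ) _ hc)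
  simp only [toAdd_act_apply, toAdd_ofAdd, Matrix.mulVec_single, Pi.smul_apply, Matrix.col_apply, MulOpposite.smul_eq_mul_unop,
    MulOpposite.unop_op, smul_eq_mul] at h2
  exact h2.symm

/-- **Step 1**: a centraliser element of `vSub n` has character `1` (diagonal entries) and `σ a = 1` (off-diagonal entries). [cite: MochizukiFrdI2008, §0 p.13] -/
theorem right_eq_one_of_mem_centralizer [NeZero r] (hdiag : ∀ a (j : Fin r), σ a j j = 1) (hinj : ∀ a, σ a = 1 → a = 1) {n : ℕ}
    {g : Compat r σ} (hg : g ∈ Subgroup.centralizer (vSub r σ n : Set (Compat r σ))) : (g : Grp r σ).right = 1 := by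
  have hc1 : (g : Grp r σ).right.1 = 1 := by
    funext m
    refine eq_one_of_mul_natCast (N := M n) (Nat.factorial_pos _) (g : Grp r σ).right.1 (fun i j h => resC_right_eq r σ g h) (fun i => ?_) m
    have h2 := kummerProbe_entry hg (0 : Fin r) 0 i
    rw [RingHom.mapMatrix_apply, Matrix.map_apply, hdiag, map_one, one_mul, Pi.single_eq_same] at h2
    exact h2.symm
  refine Prod.ext hc1 (hinj _ (Matrix.ext fun l j => ?_))
  by_cases hlj : l = j
  · subst hlj
    rw [hdiag, Matrix.one_apply_eq]
  rw [Matrix.one_apply_ne hlj]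
  refine int_eq_zero_of_mul_natCast (N := M n) (Nat.factorial_pos _) _ fun i => ?_
  have h2 := kummerProbe_entry hg j l i
  rw [Pi.single_eq_of_ne hlj, hc1, Pi.one_apply, Units.val_one, one_mul, RingHom.mapMatrix_apply, Matrix.map_apply, Int.coe_castRingHom] at h2
  rw [Int.cast_mul, Int.cast_natCast]
  exact h2.symm

/-- **Step 2**: a centraliser element of `vSub n` has ALL Kummer classes trivial (divisible by every prime power of every `M m`). [cite: MochizukiFrdI2008, §0 p.13] -/
theorem left_eq_one_of_mem_centralizer {n : ℕ} {g : Compat r σ} (hg : g ∈ Subgroup.centralizer (vSub r σ n : Set (Compat r σ))) :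
    (g : Grp r σ).left = 1 := by
  refine Multiplicative.toAdd.injective (funext fun m => funext fun l => ?_)
  rw [toAdd_one, Pi.zero_apply, Pi.zero_apply]
  haveI : NeZero (M m) := ⟨(Nat.factorial_pos (m + 2)).ne'⟩
  suffices hdvd : M m ∣ ((g : Grp r σ).left.toAdd m l).val from (ZMod.val_eq_zero _).1 (Nat.eq_zero_of_dvd_of_lt hdvd (ZMod.val_lt _))
  refine (Nat.dvd_iff_prime_pow_dvd_dvd _ (M m)).2 fun p k hp hpk => ?_
  refine (pow_dvd_pow p ((hp.pow_dvd_iff_le_factorization (Nat.factorial_pos (m + 2)).ne').1 hpk)).trans ?_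
  obtain ⟨t, u, x, ht0, hx, hxe, hu⟩ := exists_unitProbe r σ p n hp
  set N := t * M n with hNdef
  have hN : 0 < N := Nat.mul_pos ht0 (Nat.factorial_pos _)
  set i := m + N with hidef
  haveI : NeZero (M i) := ⟨(Nat.factorial_pos (i + 2)).ne'⟩
  set X : ℕ := ((g : Grp r σ).left.toAdd i l).val with hX
  have h1 := congrArg SemidirectProduct.left (congrArg Subtype.val (Subgroup.mem_centralizer_iff.1 hg x hx))
  rw [Subgroup.coe_mul, Subgroup.coe_mul, hxe, SemidirectProduct.mul_left, SemidirectProduct.mul_left, SemidirectProduct.left_inr,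
    SemidirectProduct.right_inr, one_mul, map_one, mul_one] at h1
  have hfix := congrArg (fun k : Kum r => ZMod.castHom (Nat.ordProj_dvd (M i) p) (ZMod (ordProj[p] (M i))) (k.toAdd i l)) h1
  simp only [toAdd_act_apply, red_sigma_one, Matrix.one_mulVec, Pi.smul_apply, smul_eq_mul, map_mul, hu i] at hfix
  rw [ZMod.castHom_apply, ZMod.cast_eq_val, ← hX, ← Nat.cast_mul, ZMod.natCast_eq_natCast_iff, add_mul, one_mul] at hfix
  have hPi : ordProj[p] (M i) ∣ N * X :=
    (Nat.modEq_zero_iff_dvd).1 (Nat.ModEq.add_right_cancel' X (by rw [zero_add, add_comm]; exact hfix : N * X + X ≡ 0 + X [MOD ordProj[p] (M i)]))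
  have hPm : ordProj[p] (M m) * ordProj[p] N ∣ ordProj[p] (M i) := by
    rw [← Nat.ordProj_mul p (Nat.factorial_pos (m + 2)).ne' hN.ne']
    exact Nat.ordProj_dvd_ordProj_of_dvd (Nat.factorial_pos (i + 2)).ne' (M_mul_dvd_M_add m hN) p
  have h3 : ordProj[p] N * ordProj[p] (M m) ∣ ordProj[p] N * (ordCompl[p] N * X) := by
    rw [← mul_assoc, Nat.ordProj_mul_ordCompl_eq_self, mul_comm (ordProj[p] N)]
    exact hPm.trans hPi
  have h5 : ordProj[p] (M m) ∣ X :=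
    ((Nat.coprime_ordCompl hp hN.ne').pow_left _).dvd_of_dvd_mul_left (Nat.dvd_of_mul_dvd_mul_left (Nat.ordProj_pos N p) h3)
  rw [← res_coord_eq r σ g (Nat.le_add_right m N) l, ZMod.castHom_apply, ZMod.cast_eq_val, ZMod.val_natCast]
  exact (Nat.dvd_mod_iff (Nat.ordProj_dvd (M m) p)).2 h5

/-- **The centraliser of every `vSub n` in `Compat r σ` is trivial** (`r ≠ 0`; `σ` unipotent-diagonal, injective). [cite: MochizukiFrdI2008, §0 p.13] -/
theorem centralizer_vSub_eq_bot [NeZero r] (hdiag : ∀ a (j : Fin r), σ a j j = 1) (hinj : ∀ a, σ a = 1 → a = 1) (n : ℕ) :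
    Subgroup.centralizer (vSub r σ n : Set (Compat r σ)) = ⊥ :=
  (Subgroup.eq_bot_iff_forall _).2 fun _ hg =>
    Subtype.ext (SemidirectProduct.ext (left_eq_one_of_mem_centralizer hg) (right_eq_one_of_mem_centralizer hdiag hinj hg))

/-- **[FrdI] §0: `Ẑ(1)^r ⋊ (Ẑˣ × ℤ_γ)` is temp-slim** — every open subgroup contains some `vSub n` (★ `exists_vSub_subset_of_isOpen`), whose
centraliser is trivial (`r ≠ 0`; `σ` unipotent-diagonal, injective). [cite: MochizukiFrdI2008, §0 p.13] -/
theorem isSlimGroup_compat [NeZero r] (hdiag : ∀ a (j : Fin r), σ a j j = 1) (hinj : ∀ a, σ a = 1 → a = 1) : IsSlimGroup (Compat r σ) := by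
  refine ⟨fun H hH => ?_⟩
  obtain ⟨n, hn⟩ := exists_vSub_subset_of_isOpen r σ hH H.one_mem
  exact le_bot_iff.1 ((Subgroup.centralizer_le hn).trans (centralizer_vSub_eq_bot hdiag hinj n).le)


/-- **«GRP₃′» is temp-slim** (the theta shear has `1`'s on the diagonal; entry `(1,0)` of `σ_a` is `a`). [cite: MochizukiFrdI2008, §0 p.13] -/
theorem isSlimGroup_compat₃' : IsSlimGroup Compat₃' := by
  refine isSlimGroup_compat (fun a j => ?_) fun a h => ?_
  · rw [thetaShear_apply, thetaShearMat]
    fin_cases j <;> rfl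
  · have h1 := congrArg (fun A : Matrix (Fin 3) (Fin 3) ℤ => A 1 0) h
    simp only [thetaShear_apply, thetaShearMat, Matrix.one_apply_ne (by decide : (1 : Fin 3) ≠ 0)] at h1
    exact Multiplicative.toAdd.injective (by simpa using h1)

/-- **The base `B^temp(Compat₃′)⁰` of the [EtTh] Def. 3.6 design carrier of record is a SLIM category** (★ `isSlim_connectedPart_bTemp` with
★ `isTempered_compat₃'`): the hypothesis `hsl` of ★ p544475 / the [FrdI] binder `IsSlim D` there is INHABITED. [cite: MochizukiSemiAnbd2006, Rmk 3.4.1 p.36] -/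
theorem isSlim_connectedPart_bTemp_compat₃' : IsSlim (ConnectedPart (BTemp Compat₃')) :=
  isSlim_connectedPart_bTemp isTempered_compat₃' isSlimGroup_compat₃'

end TateTowerKummerTwistRShear

namespace TemperedFrobenioid.DivisorDataRigidRefutation

open Literature.IUT.HodgeTheaters ThetaTwistTowerSmallIndex TateTowerKummerTwistRShear

/-- **At the [EtTh] Def. 3.6 design carrier of record `temperedFrobenioidSmall R S` the [IUTchI] Cor. 5.3 (iv) injectivity conclusion
`RigidOverBase` FAILS, unconditionally** — ★ `not_rigidOverBase_temperedFrobenioidSmall_of_isSlim` (p544475: cusp swap ⇒ divisor-moving data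
automorphism ⇒ forbidden at a slim base) at the now-established slimness of `B^temp(Compat₃′)⁰`.  OURS, about OUR class-(b) design carrier (two
unlabelled cusps per component) ≠ print (labelled cusps, [EtTh] Prop. 1.3); no token moved. [cite: MochizukiEtTh2009, Def 3.6 p.77] [claim: Mochizuki2012, status: disputed] -/
theorem not_rigidOverBase_temperedFrobenioidSmall (R S : ((ConnectedPart (BTemp (Compat 3 thetaShear)))ᵒᵖ ⥤ CommMonCat.{0}) → Prop) :
    ¬ CatIsomorphism.RigidOverBase (temperedFrobenioidSmall R S).baseFunctorOfCategory :=
  not_rigidOverBase_temperedFrobenioidSmall_of_isSlim R S isSlim_connectedPart_bTemp_compat₃'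

end TemperedFrobenioid.DivisorDataRigidRefutation

end Literature.AnabelianGeometry.EtaleTheta

end
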